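import Literature.NumberTheory.ComplexMultiplication.CMTypeGaloisTranslateReflexField
import Literature.NumberTheory.ComplexMultiplication.ReflexDegreePartition
import Literature.NumberTheory.ComplexMultiplication.ReflexDegreeMaximal
import Literature.NumberTheory.ComplexMultiplication.CMTypeDictionaryGroupLevel
import Literature.AlgebraicGeometry.Pohlmann1968.NondegenerateCMTypeDivisorClasses
import HarnessLib

/-!
# A single Galois class of CM types: `⟺` some (every) type has the maximal reflex degree `2^g`; it forces every type
# to be nondegenerate and primitive and every CM point of `K` on `𝔥_g` to be simple; Dodson's case `v = n`
# (`[Kᶜ : K₀ᶜ] = 2ⁿ`) gives one class (Dodson 1984 §1.3 Remark, §5.1.3; Ribet 1980 Cor. 3.6; DIS 2022 Prop. 12)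

Layer `Literature/NumberTheory/ComplexMultiplication`, namespace `Literature.NumberTheory.ComplexMultiplication` (lane
`lit-hodgefound`, Track 2 foundations, Layer A3; seat `lit-hodgefound-p11`, generation 24, row g24-#9).  Sequel of
`CMTypeGaloisEquivalence` (g24-#5: `cmTypeGaloisSetoid K`), `CMTypeGaloisClassReflexDegree` (g24-#6: the Galois class
of `Φ` has `[ℚ(tr_Φ) : ℚ]` members) on the tree's `ReflexDegreePartition` («one Galois class ⟹ nondegenerate»,
`isNondegenerate_of_forall_exists_smul_eq`, and the `Aut(ℂ) ↔ Gal(L/ℚ)` dictionary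
`exists_smul_eq_of_smul_algValuedIn_eq`), `ReflexDegreeMaximal` (Dodson's case `v = n`:
`exists_smul_eq_of_finrank_normalClosure_eq`) and `Pohlmann1968.IsNondegenerate.isPrimitive` (Kubota).  THEOREMS
ONLY; no definition, no named fact (D-0026).

THE PRINT.  B. Dodson, *The structure of Galois groups of CM-fields*, Trans. AMS 283 (1984), §1.3 Remark (p. 5):
«Note that `[K′ : ℚ]` is also the order of the orbit of `Φ` under the `G`-action»; §5.1.3 Proposition 1 (p. 20) and
its proof: «the case `v = n` gives a single orbit».  K. Ribet, *Division fields of abelian varieties with complex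
multiplication* (1980), §3 Cor. (3.6) (p. 87): `n* = 2ⁿ⁻¹ ⟹ Φ` nondegenerate.  B. Dina, S. Ionica, J. Sijsling
(2022), §1.2 Prop. 12: «Let `K` be a sextic CM field with Galois group `C₂³ ⋊ C₃` or `C₂³ ⋊ S₃`. Then `K` admits
`4` CM types up to equivalence, which are all primitive. Up to Galois equivalence, `K` admits `1` CM type.»

WHAT IS PROVED (`K` a CM field of degree `2g`, `Φ : CMType K`, `K*_Φ = ℚ(tr_Φ) ⊂ ℂ`).
* §1 **`card_cmTypeGaloisClasses_eq_one_iff`**: one Galois class `⟺` any two types are Galois equivalent;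
  **`forall_rel_iff_finrank_traceField_eq_two_pow`**: the class of `Φ` is everything `⟺ [K*_Φ : ℚ] = 2^g`
  (g24-#6); hence **`card_cmTypeGaloisClasses_eq_one_iff_exists`** / **`…_iff_forall`**: one Galois class `⟺` some
  `⟺` every CM type has the maximal reflex degree `2^g` (Dodson §1.3 Remark; Ribet (3.1)).
* §2 consequences of a single class: **`isNondegenerate_of_card_cmTypeGaloisClasses_eq_one`** (every type
  nondegenerate — Ribet Cor. 3.6, the tree's `isNondegenerate_of_forall_exists_smul_eq` on the Galois closure
  `K^c ⊂ ℂ`), **`isPrimitive_of_card_cmTypeGaloisClasses_eq_one`** (every type primitive, Kubota),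
  `not_exists_inducedCMType_of_card_cmTypeGaloisClasses_eq_one`, and on `𝔥_g`:
  **`SiegelCMPoint.IsCMPointOf.isSimple_of_card_cmTypeGaloisClasses_eq_one`** (every CM point of `K` on `𝔥_g` has a
  simple torus).
* §3 **`card_cmTypeGaloisClasses_eq_one_of_finrank_normalClosure_eq`**: Dodson's case `v = n` — if
  `[L : K₀ᶜ] = 2^g` for a normal closure `L` of `K` (`K₀ᶜ ⊆ L` the normal closure of the maximal real subfield), then
  there is exactly ONE Galois class (DIS Prop. 12 for sextic fields with group `C₂³ ⋊ C₃`, `C₂³ ⋊ S₃`; the generic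
  CM field `(ℤ₂)ⁿ ⋊ 𝔖ₙ`), so all the consequences of §2 hold there.

## References

* [Dodson1984] B. Dodson, *The structure of Galois groups of CM-fields*, Trans. AMS 283 (1984), §1.3 Remark (p. 5),
  §5.1.3 Proposition 1 (p. 20).
* [Ribet1980] K. A. Ribet, *Division fields of abelian varieties with complex multiplication*, Mém. SMF (1980), §3
  (3.1) and Cor. (3.6).
* [DinaIonicaSijsling2022] B. Dina, S. Ionica, J. Sijsling, Math. Comp. 91 (2022), §1.2 Def. 8, Prop. 12.
* [Shimura1998] G. Shimura, *Abelian Varieties with Complex Multiplication and Modular Functions* (1998), §8.2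
  Prop. 26, §8.3 Prop. 28.

## Provenance

Lane `lit-hodgefound` (HOME `run/shared/lean/pub/lit-hodgefound/`), prover seat `lit-hodgefound-p11` (gen 24),
self-proposed row g24-#9 (INBOX claim 2026-08-27, l.40183).
-/

set_option autoImplicit false

noncomputable section

open scoped Classical NumberField Pointwise
open NumberField Module IntermediateField

namespace Literature.NumberTheory.ComplexMultiplication

open Literature.AlgebraicGeometry.Motives (CMType)
open Literature.AlgebraicGeometry.Motives.HodgeStructure (cmTypeSmul cmTypeSmul_val)
open Literature.AlgebraicGeometry (GaoUllmo2025.galoisClosure GaoUllmo2025.corestrict)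

variable {K : Type} [Field K] [NumberField K] [IsCMField K]

/-! ## §1 One Galois class `⟺` maximal reflex degree -/

section One

/-- `τΦ = Ψ` at the level of sets: `cmTypeSmul τ Φ = Ψ ↔ τ • Φ = Ψ`. [cite: DinaIonicaSijsling2022, §1.2 Def. 8] -/
theorem cmTypeSmul_eq_iff_smul_val_eq (τ : ℂ ≃+* ℂ) (Φ Ψ : CMType K) : cmTypeSmul τ Φ = Ψ ↔ τ • Φ.1 = Ψ.1 := by
  rw [← cmTypeSmul_val]
  exact ⟨fun h => h ▸ rfl, fun h => Subtype.ext h⟩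

/-- There is at least one Galois class (CM types exist). [cite: DinaIonicaSijsling2022, §1.2 Def. 8] -/
theorem nonempty_cmTypeGaloisClasses : Nonempty (Quotient (cmTypeGaloisSetoid K)) := by
  haveI : Finite (CMType K) := finite_cmType
  have hpos : 0 < Nat.card (CMType K) := by rw [CMTypeCount.natCard_cmType]; positivity
  obtain ⟨Φ⟩ := (Nat.card_pos_iff.1 hpos).1
  exact ⟨Quotient.mk _ Φ⟩

/-- **One Galois class `⟺` any two CM types are Galois equivalent.** [cite: DinaIonicaSijsling2022, §1.2 Def. 8 and Prop. 12]
[cite: Dodson1984, §5.1.3 Proposition 1 (proof)] -/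
theorem card_cmTypeGaloisClasses_eq_one_iff :
    Nat.card (Quotient (cmTypeGaloisSetoid K)) = 1 ↔ ∀ Φ Ψ : CMType K, (cmTypeGaloisSetoid K).r Φ Ψ := by
  haveI : Finite (CMType K) := finite_cmType
  haveI := nonempty_cmTypeGaloisClasses (K := K)
  rw [Nat.card_eq_one_iff_unique]
  constructor
  · rintro ⟨hs, -⟩ Φ Ψ
    haveI := hs
    exact Quotient.exact (Subsingleton.elim (Quotient.mk (cmTypeGaloisSetoid K) Φ) (Quotient.mk _ Ψ))
  · intro h
    refine ⟨⟨fun q q' => ?_⟩, inferInstance⟩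
    obtain ⟨Φ, rfl⟩ := Quotient.exists_rep q
    obtain ⟨Ψ, rfl⟩ := Quotient.exists_rep q'
    exact Quotient.sound (h Φ Ψ)

/-- **The Galois class of `Φ` is all of the `2^g` types `⟺ [K*_Φ : ℚ] = 2^g`** («`[K′ : ℚ]` is also the order of the
orbit of `Φ`», g24-#6). [cite: Dodson1984, §1.3 Remark (p. 5)] [cite: Ribet1980, §3 (3.1)] -/
theorem forall_rel_iff_finrank_traceField_eq_two_pow (Φ : CMType K) :
    (∀ Ψ : CMType K, (cmTypeGaloisSetoid K).r Φ Ψ) ↔ finrank ℚ (traceField Φ) = 2 ^ (finrank ℚ K / 2) := by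
  haveI : Finite (CMType K) := finite_cmType
  rw [← natCard_galoisClass_eq_finrank_traceField, ← CMTypeCount.natCard_cmType]
  constructor
  · intro h
    exact Nat.card_congr (Equiv.subtypeUnivEquiv fun Ψ => h Ψ)
  · intro h Ψ
    by_contra hΨ
    have hlt := Finite.card_subtype_lt (p := fun Ψ : CMType K => ∃ τ : ℂ ≃+* ℂ, Ψ = cmTypeSmul τ Φ) (x := Ψ) hΨ
    omega

/-- **One Galois class `⟺` SOME CM type has reflex degree `2^g`.** [cite: Dodson1984, §1.3 Remark (p. 5)]
[cite: Ribet1980, §3 (3.1) and Cor. (3.6)] -/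
theorem card_cmTypeGaloisClasses_eq_one_iff_exists :
    Nat.card (Quotient (cmTypeGaloisSetoid K)) = 1 ↔ ∃ Φ : CMType K, finrank ℚ (traceField Φ) = 2 ^ (finrank ℚ K / 2) := by
  rw [card_cmTypeGaloisClasses_eq_one_iff]
  constructor
  · intro h
    obtain ⟨q⟩ := nonempty_cmTypeGaloisClasses (K := K)
    obtain ⟨Φ, -⟩ := Quotient.exists_rep q
    exact ⟨Φ, (forall_rel_iff_finrank_traceField_eq_two_pow Φ).1 (h Φ)⟩
  · rintro ⟨Φ, hΦ⟩ Ψ Θ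
    have hΦ' := (forall_rel_iff_finrank_traceField_eq_two_pow Φ).2 hΦ
    exact (cmTypeGaloisSetoid K).trans ((cmTypeGaloisSetoid K).symm (hΦ' Ψ)) (hΦ' Θ)

/-- **One Galois class `⟺` EVERY CM type has reflex degree `2^g`.** [cite: Dodson1984, §1.3 Remark (p. 5)]
[cite: Ribet1980, §3 (3.1) and Cor. (3.6)] -/
theorem card_cmTypeGaloisClasses_eq_one_iff_forall :
    Nat.card (Quotient (cmTypeGaloisSetoid K)) = 1 ↔ ∀ Φ : CMType K, finrank ℚ (traceField Φ) = 2 ^ (finrank ℚ K / 2) := by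
  rw [card_cmTypeGaloisClasses_eq_one_iff]
  exact ⟨fun h Φ => (forall_rel_iff_finrank_traceField_eq_two_pow Φ).1 (h Φ),
    fun h Φ Ψ => (forall_rel_iff_finrank_traceField_eq_two_pow Φ).2 (h Φ) Ψ⟩

/-- More than one Galois class `⟺` every reflex degree is `< 2^g`. [cite: Dodson1984, §1.3 Remark (p. 5)]
[cite: Ribet1980, §3 (3.1)] -/
theorem one_lt_card_cmTypeGaloisClasses_iff :
    1 < Nat.card (Quotient (cmTypeGaloisSetoid K)) ↔ ∀ Φ : CMType K, finrank ℚ (traceField Φ) < 2 ^ (finrank ℚ K / 2) := by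
  haveI := finite_cmTypeGaloisClasses (K := K)
  haveI := nonempty_cmTypeGaloisClasses (K := K)
  have hpos : 0 < Nat.card (Quotient (cmTypeGaloisSetoid K)) := Nat.card_pos
  constructor
  · intro h Φ
    refine lt_of_le_of_ne (finrank_traceField_le_two_pow Φ) fun heq => ?_
    have h1 := card_cmTypeGaloisClasses_eq_one_iff_exists.2 ⟨Φ, heq⟩
    omega
  · intro h
    by_contra hle
    have h1 : Nat.card (Quotient (cmTypeGaloisSetoid K)) = 1 := by omega
    obtain ⟨Φ, hΦ⟩ := card_cmTypeGaloisClasses_eq_one_iff_exists.1 h1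
    exact absurd hΦ (h Φ).ne

end One

/-! ## §2 A single Galois class forces nondegeneracy, primitivity, simplicity -/

section Consequences

/-- **One Galois class ⟹ every CM type of `K` is NONDEGENERATE** (Ribet's Cor. (3.6) through the tree's
`isNondegenerate_of_forall_exists_smul_eq`, read in the Galois closure `K^c ⊂ ℂ`). [cite: Ribet1980, §3 Cor. (3.6) (p. 87)]
[cite: Dodson1984, §5.1.3 Proposition 1 (proof)] -/
theorem isNondegenerate_of_card_cmTypeGaloisClasses_eq_one (h1 : Nat.card (Quotient (cmTypeGaloisSetoid K)) = 1)
    (Ψ : CMType K) : Literature.AlgebraicGeometry.Pohlmann1968.IsNondegenerate Ψ := by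
  obtain ⟨φ₀⟩ := (inferInstance : Nonempty (K →+* ℂ))
  have h := card_cmTypeGaloisClasses_eq_one_iff.1 h1
  refine isNondegenerate_of_forall_exists_smul_eq (GaoUllmo2025.corestrict K φ₀.toRatAlgHom) (Φ := Ψ)
    (fun Θ => ?_) Ψ
  obtain ⟨τ, hτ⟩ := h Ψ Θ
  exact ⟨τ, (cmTypeSmul_eq_iff_smul_val_eq τ Ψ Θ).1 hτ.symm⟩

/-- **One Galois class ⟹ every CM type of `K` is PRIMITIVE** (nondegenerate ⟹ primitive, Kubota; tree
`IsNondegenerate.isPrimitive`). [cite: Ribet1980, §3 Cor. (3.6) (p. 87)] [cite: DinaIonicaSijsling2022, §1.2 Prop. 12] -/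
theorem isPrimitive_of_card_cmTypeGaloisClasses_eq_one (h1 : Nat.card (Quotient (cmTypeGaloisSetoid K)) = 1)
    (Ψ : CMType K) (φ₀ : K →+* ℂ) : IsPrimitive (ℂ ≃+* ℂ) Ψ.1 φ₀ :=
  (isNondegenerate_of_card_cmTypeGaloisClasses_eq_one h1 Ψ).isPrimitive φ₀

/-- One Galois class ⟹ no CM type of `K` is induced from a strict subfield. [cite: DinaIonicaSijsling2022, §1.2 Prop. 12]
[cite: Shimura1998, §8.2 Prop. 26] -/
theorem not_exists_inducedCMType_of_card_cmTypeGaloisClasses_eq_one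
    (h1 : Nat.card (Quotient (cmTypeGaloisSetoid K)) = 1) (Ψ : CMType K) :
    ¬ ∃ (k : IntermediateField ℚ K) (Θ : CMType k), k ≠ ⊤ ∧ inducedCMType (algebraMap k K) Θ = Ψ := by
  obtain ⟨φ₀⟩ := (inferInstance : Nonempty (K →+* ℂ))
  exact (SiegelCMPoint.not_exists_inducedCMType_iff_isPrimitive Ψ φ₀).2
    (isPrimitive_of_card_cmTypeGaloisClasses_eq_one h1 Ψ φ₀)

/-- One Galois class ⟹ every Streng class is a primitive class: `#{primitive classes} = #{classes}` (DIS Prop. 12: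
«`4` CM types up to equivalence, which are all primitive»). [cite: DinaIonicaSijsling2022, §1.2 Prop. 12] -/
theorem card_classes_not_induced_eq_card_classes_of_card_cmTypeGaloisClasses_eq_one
    (h1 : Nat.card (Quotient (cmTypeGaloisSetoid K)) = 1) :
    Nat.card {q : Quotient (cmTypeEquivSetoid K) // ∀ Φ : CMType K, Quotient.mk _ Φ = q →
        ¬ ∃ (k : IntermediateField ℚ K) (Θ : CMType k), k ≠ ⊤ ∧ inducedCMType (algebraMap k K) Θ = Φ} =
      Nat.card (Quotient (cmTypeEquivSetoid K)) :=
  Nat.card_congr (Equiv.subtypeUnivEquiv fun _ Φ _ => not_exists_inducedCMType_of_card_cmTypeGaloisClasses_eq_one h1 Φ)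

open Literature.NumberTheory.Automorphic (siegelUpperHalfSpace)
open Literature.AlgebraicGeometry.ModuliOfAbelianVarieties.SiegelModuli (prinPeriod)
open Literature.Geometry.Kaehler.ComplexTorus (IsIsogenous IsSimple)

/-- **One Galois class ⟹ every CM point of `K` on `𝔥_g` has a SIMPLE torus** (simple ⟺ primitive type, Shimura
Prop. 26 on `𝔥_g`, the tree's `IsCMPointOf.isSimple_iff_not_exists_inducedCMType`). [cite: Shimura1998, §8.2 Prop. 26]
[cite: DinaIonicaSijsling2022, §1.2 Prop. 12] -/
theorem SiegelCMPoint.IsCMPointOf.isSimple_of_card_cmTypeGaloisClasses_eq_one {g : ℕ} {Z : siegelUpperHalfSpace g}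
    {h : K →ₐ[ℚ] Matrix (Fin g ⊕ Fin g) (Fin g ⊕ Fin g) ℚ} (hK : finrank ℚ K = 2 * g)
    (hZ : SiegelCMPoint.IsCMPointOf h Z) (h1 : Nat.card (Quotient (cmTypeGaloisSetoid K)) = 1) :
    IsSimple (prinPeriod Z) :=
  (hZ.isSimple_iff_not_exists_inducedCMType hK).2
    (not_exists_inducedCMType_of_card_cmTypeGaloisClasses_eq_one h1 (hZ.cmType hK))

/-- … so the isogeny classes of the simple CM points of `K` on `𝔥_g` are in bijection with ALL Streng classes
(g24-#3 `card_isogenyClasses_eq_card_classes_of_forall`). [cite: Streng2010, Ch. I Lemma 5.6, p. 26]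
[cite: DinaIonicaSijsling2022, §1.2 Prop. 12] -/
theorem SiegelCMPoint.card_isogenyClasses_eq_card_classes_of_card_cmTypeGaloisClasses_eq_one {g : ℕ}
    (hK : finrank ℚ K = 2 * g) (h1 : Nat.card (Quotient (cmTypeGaloisSetoid K)) = 1) :
    Nat.card (Quotient (SiegelCMPoint.isogenySetoid K g)) = Nat.card (Quotient (cmTypeEquivSetoid K)) :=
  SiegelCMPoint.card_isogenyClasses_eq_card_classes_of_forall hK
    (not_exists_inducedCMType_of_card_cmTypeGaloisClasses_eq_one h1)

end Consequences

/-! ## §3 Dodson's case `v = n`: `[Kᶜ : K₀ᶜ] = 2ⁿ` gives a single Galois class -/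

section MaximalKernel

variable {L : Type} [Field L] [NumberField L] [IsCMField L] [IsNormalClosure ℚ K L]

/-- **`v = n` ⟹ ONE Galois class**: if `[L : K₀ᶜ] = 2^g` for a normal closure `L` of `K` (`K₀ᶜ` the normal closure
in `L` of the maximal real subfield `K₀ = K⁺`), then any two CM types of `K` are Galois equivalent — Dodson's «the
case `v = n` gives a single orbit» (tree `exists_smul_eq_of_finrank_normalClosure_eq`, read back in `Aut(ℂ)` by the
dictionary `exists_smul_eq_of_smul_algValuedIn_eq`).  For sextic `K` with `Gal(Kᶜ/ℚ) = C₂³ ⋊ C₃` or `C₂³ ⋊ S₃`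
this is DIS Prop. 12 «Up to Galois equivalence, `K` admits `1` CM type». [cite: Dodson1984, §5.1.3 Proposition 1 (proof)]
[cite: DinaIonicaSijsling2022, §1.2 Prop. 12] -/
theorem card_cmTypeGaloisClasses_eq_one_of_finrank_normalClosure_eq (j : K →ₐ[ℚ] L)
    (hv : finrank (normalClosure ℚ (maximalRealSubfield K) L) L = 2 ^ (finrank ℚ K / 2)) :
    Nat.card (Quotient (cmTypeGaloisSetoid K)) = 1 := by
  haveI : Normal ℚ L := IsNormalClosure.normal (F := ℚ) (K := K) (L := L)
  obtain ⟨ι⟩ : Nonempty (L →+* ℂ) := inferInstance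
  refine card_cmTypeGaloisClasses_eq_one_iff.2 fun Φ Ψ => ?_
  obtain ⟨σ, hσ⟩ := exists_smul_eq_of_finrank_normalClosure_eq j hv (isCMTypeWith_conjGal_algValuedIn ι Φ)
    (isCMTypeWith_conjGal_algValuedIn ι Ψ)
  obtain ⟨τ, hτ⟩ := exists_smul_eq_of_smul_algValuedIn_eq j ι hσ
  exact ⟨τ, ((cmTypeSmul_eq_iff_smul_val_eq τ Φ Ψ).2 hτ).symm⟩

/-- `v = n` ⟹ every CM type of `K` has reflex degree `2^g` (model-free form of the tree's
`finrank_reflexField_eq_two_pow_of_finrank_normalClosure_eq`). [cite: Dodson1984, §1.3 Reflex Degree Theorem and §5.1.3] -/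
theorem finrank_traceField_eq_two_pow_of_finrank_normalClosure_eq (j : K →ₐ[ℚ] L)
    (hv : finrank (normalClosure ℚ (maximalRealSubfield K) L) L = 2 ^ (finrank ℚ K / 2)) (Φ : CMType K) :
    finrank ℚ (traceField Φ) = 2 ^ (finrank ℚ K / 2) :=
  card_cmTypeGaloisClasses_eq_one_iff_forall.1 (card_cmTypeGaloisClasses_eq_one_of_finrank_normalClosure_eq j hv) Φ

/-- `v = n` ⟹ every CM type of `K` is primitive and every CM point of `K` on `𝔥_g` is simple.
[cite: Dodson1984, §5.1.3 Proposition 1] [cite: DinaIonicaSijsling2022, §1.2 Prop. 12] -/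
theorem isPrimitive_of_finrank_normalClosure_eq (j : K →ₐ[ℚ] L)
    (hv : finrank (normalClosure ℚ (maximalRealSubfield K) L) L = 2 ^ (finrank ℚ K / 2)) (Φ : CMType K)
    (φ₀ : K →+* ℂ) : IsPrimitive (ℂ ≃+* ℂ) Φ.1 φ₀ :=
  isPrimitive_of_card_cmTypeGaloisClasses_eq_one (card_cmTypeGaloisClasses_eq_one_of_finrank_normalClosure_eq j hv) Φ φ₀

end MaximalKernel

end Literature.NumberTheory.ComplexMultiplication
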